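import Summits.CriticalPhenomena.PercolationContinuityZ3.Theorems.PercAnnulusCrossingIICVolumeTailFiniteStep
import Summits.CriticalPhenomena.PercolationContinuityZ3.Theorems.PercAnnulusCrossingIICVolumeTailReduction
import HarnessLib

/-!
# The volume of Kesten's IIC has an exponential upper tail, IX: the FINITE-VOLUME tree bound `P_p(A_N ∩ ⋂{0 ↔ z_i in Λ(R)}) ≤ C^k ∏ π(r_i) · π_p(N − k(2D+2))` (lane RSW3, p1 gen 28)

builds on p205010 (kernel theorem, internal audit signed; external expert review pending) — NOT used in this file (every `p` with `CU⁺_l` and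
the ratio bound (R2); deterministic bookkeeping).

RSW3 lane (LANE 3 `prim-rsw3`), seat `prim-rsw3-p1` (gen 28).  Helper file (`--supports stmt-CriticalPhenomena-4575`); no definitions,
no sorries.  Memo `run/shared/lean/prim/rsw3/P1-QM.md` §41.

Iterating the peeling step of part VIII along a nearest-parent listing `z_0 = 0, z_1, …, z_k ⊆ Λ(D)` (short edges `r < 2l` are dropped at
the price `1 ≤ C π(r)`, long edges peeled at the price `(B^l/c_U) π(r)` while `N ↦ N − (2D+2)` and `R ↦ R + 2D`):

* **`exists_real_siteToBoundary_inter_biInter_le_pow_mul_prod`** — every `p > 0`, `d ≥ 1`, `CU⁺_l(c_U)` (`c_U > 0`) and (R2) at `p`: there is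
  `C ≥ 1` with **`P_p({0 ↔ ∂ⁱⁿΛ(N)} ∩ ⋂_{i=1}^{k} {0 ↔ z_i in Λ(R)}) ≤ C^k · ∏_{i=1}^{k} π_p(‖z_i − z_{p(i)}‖) · π_p(N − k(2D+2))`** for every
  nearest-parent listing in `Λ(D)`, `D ≤ R`, `R + 2k(2D+2) ≤ N` — gen 22's tree bound BEFORE the limit, with the arm paying `π(N − k(2D+2))`;
* `exists_index_of_listing`, `listing_mem_box` — bookkeeping for the dedup listing of part II (`exists_nearestParent_listing_of_tuple`):
  the listed sites are entries of the tuple, hence in `Λ(n)`;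
* **`exists_real_siteToBoundary_inter_iInter_le_pow_mul_orderedWeight`** — hence for EVERY tuple `q : Fin t → Λ(n)` (`n ≤ R`,
  `R + 2t(2n+2) ≤ N`): **`P_p(A_N ∩ ⋂_a {0 ↔ q_a in Λ(R)}) ≤ C^t · W→(q) · π_p(N − t(2n+2))`**.
Part X (`…IICVolumeTailFiniteVolume`): the finite-volume factorial moments and `P(V_n ≥ λ s(n) | A_N) ≤ 2B e^{−cλ}`.
References: H. Kesten, Probab. Theory Relat. Fields 73 (1986) Thm. (8) [Kesten1986]; D. Basu, A. Sapozhnikov, ECP 22 (2017) Thm. 1.1.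
-/

noncomputable section

namespace Summit.CriticalPhenomena.PercolationContinuityZ3.Theorems.Crossing

open MeasureTheory Filter Topology Literature.Probability.Percolation Literature.Probability.LatticeModels
open Literature.Probability.Percolation.DCT16
open Summit.CriticalPhenomena.PercolationContinuityZ3.Theorems.SurfaceTension

variable {d : ℕ}

/-! ## §1 The finite-volume tree bound along a nearest-parent listing -/

/-- **THE FINITE-VOLUME TREE BOUND** (every `p > 0`, `d ≥ 1`; `CU⁺_l(c_U)` at `p`, `l ≥ 2`, `c_U > 0`; (R2) `π(j) ≤ Bπ(m)` for `1 ≤ j ≤ m ≤ 8j`):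
there is `C ≥ 1` such that for every `k`, every nearest-parent listing `z_0 = 0, z_1, …, z_k` (`p(i) < i`,
`1 ≤ ‖z_i − z_{p(i)}‖ ≤ ‖z_i − z_j‖` for `j < i`) of sites of `Λ(D)`, every `R ≥ D` and every `N ≥ R + 2k(2D+2)`:
**`P_p({0 ↔ ∂ⁱⁿΛ(N)} ∩ ⋂_{i=1}^{k} {0 ↔ z_i in Λ(R)}) ≤ C^k · ∏_{i=1}^{k} π_p(‖z_i − z_{p(i)}‖) · π_p(N − k(2D+2))`**
(induction on `k` with `real_siteToBoundary_inter_biInter_le_mul_peel`; `C = max(B^l/c_U, 1/π(2l), 1)`).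
[cite: Kesten1986, Thm. (8)] [cite: BasuSapozhnikov2017ECP, Thm. 1.1 and Remark 2.1] -/
theorem exists_real_siteToBoundary_inter_biInter_le_pow_mul_prod (hd : 1 ≤ d) (p : unitInterval) (hp : 0 < (p : ℝ)) {l : ℕ}
    (hl : 2 ≤ l) {cU : ℝ} (hcU : 0 < cU)
    (hCU : ∀ a : ℕ, 1 ≤ a → ∀ E : Set (BondConfig (Site d)), IsUpperSet E → MeasurableSet E →
      cU * (bondPercolation (zdGraph d) p).real E ≤ (bondPercolation (zdGraph d) p).real (E ∩
        {ω : BondConfig (Site d) | ∀ t ∈ innerBoundary (zdGraph d) (box d a), ∀ s ∈ innerBoundary (zdGraph d) (box d (l * a)),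
        ∀ t' ∈ innerBoundary (zdGraph d) (box d a), ∀ s' ∈ innerBoundary (zdGraph d) (box d (l * a)),
        ω ∈ openConnIn (↑((box d (l * a) \ box d a) ∪ innerBoundary (zdGraph d) (box d a)) : Set (Site d)) t s →
        ω ∈ openConnIn (↑((box d (l * a) \ box d a) ∪ innerBoundary (zdGraph d) (box d a)) : Set (Site d)) t' s' →
        ω ∈ openConnIn (↑((box d (l * a) \ box d a) ∪ innerBoundary (zdGraph d) (box d a)) : Set (Site d)) s s'}))
    {B : ℝ} (hR2 : ∀ j m : ℕ, 1 ≤ j → j ≤ m → m ≤ 8 * j → oneArmProb d p j ≤ B * oneArmProb d p m) :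
    ∃ C : ℝ, 1 ≤ C ∧ ∀ (k : ℕ) (z : ℕ → Site d) (par : ℕ → ℕ) (D R N : ℕ), z 0 = 0 → (∀ i, 1 ≤ i → i ≤ k → par i < i) →
      (∀ i, 1 ≤ i → i ≤ k → 1 ≤ Site.supNorm (z i - z (par i))) →
      (∀ i, 1 ≤ i → i ≤ k → ∀ j, j < i → Site.supNorm (z i - z (par i)) ≤ Site.supNorm (z i - z j)) →
      (∀ i, i ≤ k → z i ∈ box d D) → D ≤ R → R + 2 * k * (2 * D + 2) ≤ N →
        (bondPercolation (zdGraph d) p).real (siteToBoundary d N ∩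
            ⋂ i ∈ Finset.Icc 1 k, (openConnIn (↑(box d R) : Set (Site d)) (0 : Site d) (z i) : Set (BondConfig (Site d)))) ≤
          C ^ k * (∏ i ∈ Finset.Icc 1 k, oneArmProb d p (Site.supNorm (z i - z (par i)))) * oneArmProb d p (N - k * (2 * D + 2)) := by
  classical
  have hπ : ∀ m, 0 < oneArmProb d p m := oneArmProb_pos hd p hp
  have hBl : 0 ≤ B ^ l := by
    have hB1 : 1 ≤ B := by
      have h1 := hR2 1 1 le_rfl le_rfl (by norm_num); have h2 := hπ 1; nlinarith
    exact pow_nonneg (by linarith) l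
  set C : ℝ := max (max (B ^ l / cU) (1 / oneArmProb d p (2 * l))) 1 with hC
  have hC1 : 1 ≤ C := le_max_right _ _
  have hC0 : 0 ≤ C := le_trans zero_le_one hC1
  have hCshort : ∀ r : ℕ, r ≤ 2 * l → 1 ≤ C * oneArmProb d p r := by
    intro r hr
    have h1 : oneArmProb d p (2 * l) ≤ oneArmProb d p r := real_siteToBoundary_antitone p hr
    calc (1 : ℝ) = 1 / oneArmProb d p (2 * l) * oneArmProb d p (2 * l) := by rw [one_div, inv_mul_cancel₀ (hπ _).ne']
      _ ≤ C * oneArmProb d p r :=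
          mul_le_mul ((le_max_right _ _).trans (le_max_left _ _)) h1 (hπ _).le hC0
  have hClong : B ^ l / cU ≤ C := (le_max_left _ _).trans (le_max_left _ _)
  refine ⟨C, hC1, fun k => ?_⟩
  set μ := bondPercolation (zdGraph d) p with hμ
  induction k with
  | zero =>
    intro z par D R N _ _ _ _ _ _ _
    have h0 : Finset.Icc 1 0 = ∅ := by rfl
    have hempty : (⋂ i ∈ (∅ : Finset ℕ), (openConnIn (↑(box d R) : Set (Site d)) (0 : Site d) (z i) : Set (BondConfig (Site d)))) =
        Set.univ := by ext ω; simp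
    rw [h0, Finset.prod_empty, hempty, Set.inter_univ, pow_zero, one_mul, one_mul, Nat.zero_mul, Nat.sub_zero]
    exact le_rfl
  | succ k ih =>
    intro z par D R N hz0 hpar hfar hnear hzD hDR hRN
    set s : ℕ := 2 * D + 2 with hs
    set r : ℕ := Site.supNorm (z (k + 1) - z (par (k + 1))) with hr
    -- hypotheses for the first `k` points
    have hpar' : ∀ i, 1 ≤ i → i ≤ k → par i < i := fun i h1 h2 => hpar i h1 (by omega)
    have hfar' : ∀ i, 1 ≤ i → i ≤ k → 1 ≤ Site.supNorm (z i - z (par i)) := fun i h1 h2 => hfar i h1 (by omega)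
    have hnear' : ∀ i, 1 ≤ i → i ≤ k → ∀ j, j < i → Site.supNorm (z i - z (par i)) ≤ Site.supNorm (z i - z j) :=
      fun i h1 h2 j hj => hnear i h1 (by omega) j hj
    have hzD' : ∀ i, i ≤ k → z i ∈ box d D := fun i hi => hzD i (by omega)
    have hIcc : Finset.Icc 1 (k + 1) = insert (k + 1) (Finset.Icc 1 k) := by
      ext i; simp only [Finset.mem_Icc, Finset.mem_insert]; omega
    have hnot : k + 1 ∉ Finset.Icc 1 k := by simp
    have hP0 : 0 ≤ ∏ i ∈ Finset.Icc 1 k, oneArmProb d p (Site.supNorm (z i - z (par i))) :=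
      Finset.prod_nonneg fun i _ => (hπ _).le
    rw [hIcc, Finset.prod_insert hnot]
    by_cases hshort : r < 2 * l
    · -- short last edge: drop the point
      have hsub : μ.real (siteToBoundary d N ∩ ⋂ i ∈ insert (k + 1) (Finset.Icc 1 k),
            (openConnIn (↑(box d R) : Set (Site d)) (0 : Site d) (z i) : Set (BondConfig (Site d)))) ≤
          μ.real (siteToBoundary d N ∩ ⋂ i ∈ Finset.Icc 1 k,
            (openConnIn (↑(box d R) : Set (Site d)) (0 : Site d) (z i) : Set (BondConfig (Site d)))) := by
        refine measureReal_mono (Set.inter_subset_inter_right _ ?_) (measure_ne_top _ _)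
        rw [Finset.set_biInter_insert]
        exact Set.inter_subset_right
      have hih := ih z par D R N hz0 hpar' hfar' hnear' hzD' hDR (le_trans (by nlinarith) hRN)
      have hπN : oneArmProb d p (N - k * s) ≤ oneArmProb d p (N - (k + 1) * s) :=
        real_siteToBoundary_antitone p (Nat.sub_le_sub_left (by nlinarith) N)
      have h1 := hCshort r hshort.le
      calc μ.real (siteToBoundary d N ∩ ⋂ i ∈ insert (k + 1) (Finset.Icc 1 k),
            (openConnIn (↑(box d R) : Set (Site d)) (0 : Site d) (z i) : Set (BondConfig (Site d))))
          ≤ C ^ k * (∏ i ∈ Finset.Icc 1 k, oneArmProb d p (Site.supNorm (z i - z (par i)))) * oneArmProb d p (N - k * s) :=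
            hsub.trans hih
        _ ≤ C ^ k * (∏ i ∈ Finset.Icc 1 k, oneArmProb d p (Site.supNorm (z i - z (par i)))) * oneArmProb d p (N - (k + 1) * s) *
              (C * oneArmProb d p r) := by
            have hX : 0 ≤ C ^ k * (∏ i ∈ Finset.Icc 1 k, oneArmProb d p (Site.supNorm (z i - z (par i)))) := mul_nonneg (pow_nonneg hC0 k) hP0
            calc C ^ k * (∏ i ∈ Finset.Icc 1 k, oneArmProb d p (Site.supNorm (z i - z (par i)))) * oneArmProb d p (N - k * s)
                ≤ C ^ k * (∏ i ∈ Finset.Icc 1 k, oneArmProb d p (Site.supNorm (z i - z (par i)))) * oneArmProb d p (N - (k + 1) * s) :=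
                  mul_le_mul_of_nonneg_left hπN hX
              _ = C ^ k * (∏ i ∈ Finset.Icc 1 k, oneArmProb d p (Site.supNorm (z i - z (par i)))) * oneArmProb d p (N - (k + 1) * s) * 1 :=
                  (mul_one _).symm
              _ ≤ _ := mul_le_mul_of_nonneg_left h1 (mul_nonneg hX (hπ _).le)
        _ = C ^ (k + 1) * (oneArmProb d p r * ∏ i ∈ Finset.Icc 1 k, oneArmProb d p (Site.supNorm (z i - z (par i)))) *
              oneArmProb d p (N - (k + 1) * s) := by ring
    · -- long last edge: peel it
      rw [not_lt] at hshort
      have hk1 : 1 ≤ k + 1 := by omega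
      have hfar0 : ∀ i, 1 ≤ i → i ≤ k + 1 → 1 ≤ Site.supNorm (z i) := by
        intro i h1 h2
        have h3 := hnear i h1 h2 0 (by omega)
        rw [hz0, sub_zero] at h3
        exact le_trans (hfar i h1 h2) h3
      have hnearL : ∀ j, j < k + 1 → r ≤ Site.supNorm (z (k + 1) - z j) := fun j hj => hnear (k + 1) hk1 le_rfl j hj
      have hRN1 : R + 2 * D + 1 ≤ N := by nlinarith
      have hpeel := real_siteToBoundary_inter_biInter_le_mul_peel p hl hcU.le hCU hk1 z hz0 hzD hfar0 hshort hnearL hDR hRN1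
      simp only [Nat.add_sub_cancel] at hpeel
      -- the induction hypothesis at `(R + 2D, N − s)`
      have hRN' : R + 2 * D + 2 * k * (2 * D + 2) ≤ N - (2 * D + 2) := by
        have h1 : R + 2 * (k + 1) * (2 * D + 2) ≤ N := hRN
        have e1 : 2 * (k + 1) * (2 * D + 2) = 2 * k * (2 * D + 2) + (2 * D + 2) + (2 * D + 2) := by ring
        rw [e1] at h1
        omega
      have hih := ih z par D (R + 2 * D) (N - (2 * D + 2)) hz0 hpar' hfar' hnear' hzD' (by omega) hRN'
      have hNN : N - (2 * D + 2) - k * s = N - (k + 1) * s := by rw [hs]; rw [Nat.sub_sub, add_mul, one_mul, add_comm]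
      rw [hNN] at hih
      have hratio : oneArmProb d p (r / l - 1) ≤ B ^ l * oneArmProb d p r := oneArmProb_div_sub_one_le p hR2 hπ hl hshort
      have hX : 0 ≤ C ^ k * (∏ i ∈ Finset.Icc 1 k, oneArmProb d p (Site.supNorm (z i - z (par i)))) * oneArmProb d p (N - (k + 1) * s) :=
        mul_nonneg (mul_nonneg (pow_nonneg hC0 k) hP0) (hπ _).le
      -- divide the peeling inequality by `c_U`
      have h1 : μ.real (siteToBoundary d N ∩ ⋂ i ∈ insert (k + 1) (Finset.Icc 1 k),
            (openConnIn (↑(box d R) : Set (Site d)) (0 : Site d) (z i) : Set (BondConfig (Site d)))) ≤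
          oneArmProb d p (r / l - 1) / cU * μ.real (siteToBoundary d (N - (2 * D + 2)) ∩ ⋂ i ∈ Finset.Icc 1 k,
            (openConnIn (↑(box d (R + 2 * D)) : Set (Site d)) (0 : Site d) (z i) : Set (BondConfig (Site d)))) := by
        rw [← hIcc, div_mul_eq_mul_div, le_div_iff₀ hcU, mul_comm]
        have h2 : N - 2 * D - 2 = N - (2 * D + 2) := by omega
        rw [h2] at hpeel
        exact hpeel
      calc μ.real (siteToBoundary d N ∩ ⋂ i ∈ insert (k + 1) (Finset.Icc 1 k),
            (openConnIn (↑(box d R) : Set (Site d)) (0 : Site d) (z i) : Set (BondConfig (Site d))))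
          ≤ oneArmProb d p (r / l - 1) / cU * (C ^ k * (∏ i ∈ Finset.Icc 1 k, oneArmProb d p (Site.supNorm (z i - z (par i)))) *
              oneArmProb d p (N - (k + 1) * s)) :=
            h1.trans (mul_le_mul_of_nonneg_left hih (div_nonneg (hπ _).le hcU.le))
        _ ≤ (B ^ l * oneArmProb d p r) / cU * (C ^ k * (∏ i ∈ Finset.Icc 1 k, oneArmProb d p (Site.supNorm (z i - z (par i)))) *
              oneArmProb d p (N - (k + 1) * s)) :=
            mul_le_mul_of_nonneg_right (div_le_div_of_nonneg_right hratio hcU.le) hX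
        _ = (B ^ l / cU) * oneArmProb d p r * (C ^ k * (∏ i ∈ Finset.Icc 1 k, oneArmProb d p (Site.supNorm (z i - z (par i)))) *
              oneArmProb d p (N - (k + 1) * s)) := by ring
        _ ≤ C * oneArmProb d p r * (C ^ k * (∏ i ∈ Finset.Icc 1 k, oneArmProb d p (Site.supNorm (z i - z (par i)))) *
              oneArmProb d p (N - (k + 1) * s)) :=
            mul_le_mul_of_nonneg_right (mul_le_mul_of_nonneg_right hClong (hπ _).le) hX
        _ = C ^ (k + 1) * (oneArmProb d p r * ∏ i ∈ Finset.Icc 1 k, oneArmProb d p (Site.supNorm (z i - z (par i)))) *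
              oneArmProb d p (N - (k + 1) * s) := by ring

/-! ## §2 The listing of a tuple lies in the tuple -/

/-- If `{z_0, …, z_k} = {0} ∪ range q` and `z_i ≠ 0` (`1 ≤ i ≤ k`), then every `z_i` (`1 ≤ i ≤ k`) is an entry of `q`. [folklore] -/
theorem exists_index_of_listing {t k : ℕ} {q : Fin t → Site d} {z : ℕ → Site d}
    (hval : (Finset.range (k + 1)).image z = insert (0 : Site d) (Finset.univ.image q))
    (hne : ∀ i, 1 ≤ i → i ≤ k → z i ≠ 0) {i : ℕ} (h1 : 1 ≤ i) (h2 : i ≤ k) : ∃ a : Fin t, q a = z i := by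
  classical
  have hmem : z i ∈ insert (0 : Site d) (Finset.univ.image q) := by
    rw [← hval]; exact Finset.mem_image_of_mem z (Finset.mem_range.2 (by omega))
  rcases Finset.mem_insert.1 hmem with h | h
  · exact absurd h (hne i h1 h2)
  · obtain ⟨a, -, ha⟩ := Finset.mem_image.1 h
    exact ⟨a, ha⟩

/-- If `{z_0, …, z_k} = {0} ∪ range q` with `q : Fin t → Λ(n)`, then every `z_i` (`i ≤ k`) lies in `Λ(n)`. [folklore] -/
theorem listing_mem_box {t k n : ℕ} {q : Fin t → Site d} (hq : q ∈ Fintype.piFinset (fun _ : Fin t => box d n)) {z : ℕ → Site d}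
    (hval : (Finset.range (k + 1)).image z = insert (0 : Site d) (Finset.univ.image q)) {i : ℕ} (hi : i ≤ k) : z i ∈ box d n := by
  classical
  have hmem : z i ∈ insert (0 : Site d) (Finset.univ.image q) := by
    rw [← hval]; exact Finset.mem_image_of_mem z (Finset.mem_range.2 (by omega))
  exact Rsw3.insert_image_subset_box hq hmem

/-! ## §3 The finite-volume bound for every tuple -/

open Classical in
/-- **THE FINITE-VOLUME TREE BOUND FOR EVERY TUPLE** (every `p > 0`, `d ≥ 1`; `CU⁺_l(c_U)` at `p`, (R2) at `p`): there is `C ≥ 1` such that for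
every `t`, every `q : Fin t → Λ(n)` (repetitions and the root allowed), every `R ≥ n` and every `N ≥ R + 2t(2n+2)`:
**`P_p({0 ↔ ∂ⁱⁿΛ(N)} ∩ ⋂_a {0 ↔ q_a in Λ(R)}) ≤ C^t · W→(q) · π_p(N − t(2n+2))`**, `W→(q) = ∏_a π_p(D_a(q))` the ordered weight of part I
(the dedup listing of part II is a nearest-parent listing in `Λ(n)` with `k ≤ t` points). [cite: Kesten1986, Thm. (8)]
[cite: BasuSapozhnikov2017ECP, Thm. 1.1 and Remark 2.1] -/
theorem exists_real_siteToBoundary_inter_iInter_le_pow_mul_orderedWeight (hd : 1 ≤ d) (p : unitInterval) (hp : 0 < (p : ℝ)) {l : ℕ}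
    (hl : 2 ≤ l) {cU : ℝ} (hcU : 0 < cU)
    (hCU : ∀ a : ℕ, 1 ≤ a → ∀ E : Set (BondConfig (Site d)), IsUpperSet E → MeasurableSet E →
      cU * (bondPercolation (zdGraph d) p).real E ≤ (bondPercolation (zdGraph d) p).real (E ∩
        {ω : BondConfig (Site d) | ∀ t ∈ innerBoundary (zdGraph d) (box d a), ∀ s ∈ innerBoundary (zdGraph d) (box d (l * a)),
        ∀ t' ∈ innerBoundary (zdGraph d) (box d a), ∀ s' ∈ innerBoundary (zdGraph d) (box d (l * a)),
        ω ∈ openConnIn (↑((box d (l * a) \ box d a) ∪ innerBoundary (zdGraph d) (box d a)) : Set (Site d)) t s →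
        ω ∈ openConnIn (↑((box d (l * a) \ box d a) ∪ innerBoundary (zdGraph d) (box d a)) : Set (Site d)) t' s' →
        ω ∈ openConnIn (↑((box d (l * a) \ box d a) ∪ innerBoundary (zdGraph d) (box d a)) : Set (Site d)) s s'}))
    {B : ℝ} (hR2 : ∀ j m : ℕ, 1 ≤ j → j ≤ m → m ≤ 8 * j → oneArmProb d p j ≤ B * oneArmProb d p m) :
    ∃ C : ℝ, 1 ≤ C ∧ ∀ (t n R N : ℕ) (q : Fin t → Site d), q ∈ Fintype.piFinset (fun _ : Fin t => box d n) → n ≤ R →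
      R + 2 * t * (2 * n + 2) ≤ N →
        (bondPercolation (zdGraph d) p).real (siteToBoundary d N ∩
            ⋂ a, (openConnIn (↑(box d R) : Set (Site d)) (0 : Site d) (q a) : Set (BondConfig (Site d)))) ≤
          C ^ t * (∏ a : Fin t, oneArmProb d p (((insert (0 : Site d) ((Finset.univ.filter fun b : Fin t => a < b).image q)).inf
            (fun w => ((Site.supNorm (q a - w) : ℕ) : ℕ∞))).toNat)) * oneArmProb d p (N - t * (2 * n + 2)) := by
  classical
  obtain ⟨C, hC1, htree⟩ := exists_real_siteToBoundary_inter_biInter_le_pow_mul_prod hd p hp hl hcU hCU hR2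
  have hπ : ∀ m, 0 < oneArmProb d p m := oneArmProb_pos hd p hp
  refine ⟨C, hC1, fun t n R N q hq hnR hRN => ?_⟩
  obtain ⟨k, z, par, hkt, hz0, hpar, hfar, hnear, hval, -, hprod⟩ := exists_nearestParent_listing_of_tuple q
  have hne : ∀ i, 1 ≤ i → i ≤ k → z i ≠ 0 := by
    intro i h1 h2 h
    have h3 := hnear i h1 h2 0 (by omega)
    rw [hz0, sub_zero] at h3
    have h4 := hfar i h1 h2
    have h5 : Site.supNorm (z i) = 0 := Site.supNorm_eq_zero_iff.2 h
    omega
  have hzD : ∀ i, i ≤ k → z i ∈ box d n := fun i hi => listing_mem_box hq hval hi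
  -- the tuple event is contained in the listing event
  have hsub : siteToBoundary d N ∩ (⋂ a, (openConnIn (↑(box d R) : Set (Site d)) (0 : Site d) (q a) : Set (BondConfig (Site d)))) ⊆
      siteToBoundary d N ∩ ⋂ i ∈ Finset.Icc 1 k, (openConnIn (↑(box d R) : Set (Site d)) (0 : Site d) (z i) : Set (BondConfig (Site d))) := by
    refine Set.inter_subset_inter_right _ fun ω hω => Set.mem_iInter₂.2 fun i hi => ?_
    rw [Finset.mem_Icc] at hi
    obtain ⟨a, ha⟩ := exists_index_of_listing hval hne hi.1 hi.2
    rw [← ha]; exact Set.mem_iInter.1 hω a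
  have hRN' : R + 2 * k * (2 * n + 2) ≤ N := le_trans (by nlinarith) hRN
  have h1 := htree k z par n R N hz0 hpar hfar hnear hzD hnR hRN'
  have hW0 : 0 ≤ ∏ a : Fin t, oneArmProb d p (((insert (0 : Site d) ((Finset.univ.filter fun b : Fin t => a < b).image q)).inf
      (fun w => ((Site.supNorm (q a - w) : ℕ) : ℕ∞))).toNat) := Finset.prod_nonneg fun a _ => (hπ _).le
  have hCk : C ^ k ≤ C ^ t := pow_le_pow_right₀ hC1 hkt
  have hπN : oneArmProb d p (N - k * (2 * n + 2)) ≤ oneArmProb d p (N - t * (2 * n + 2)) :=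
    real_siteToBoundary_antitone p (Nat.sub_le_sub_left (Nat.mul_le_mul_right _ hkt) N)
  calc (bondPercolation (zdGraph d) p).real (siteToBoundary d N ∩
          ⋂ a, (openConnIn (↑(box d R) : Set (Site d)) (0 : Site d) (q a) : Set (BondConfig (Site d))))
      ≤ (bondPercolation (zdGraph d) p).real (siteToBoundary d N ∩ ⋂ i ∈ Finset.Icc 1 k,
          (openConnIn (↑(box d R) : Set (Site d)) (0 : Site d) (z i) : Set (BondConfig (Site d)))) := measureReal_mono hsub (measure_ne_top _ _)
    _ ≤ C ^ k * (∏ i ∈ Finset.Icc 1 k, oneArmProb d p (Site.supNorm (z i - z (par i)))) * oneArmProb d p (N - k * (2 * n + 2)) := h1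
    _ = C ^ k * (∏ a : Fin t, oneArmProb d p (((insert (0 : Site d) ((Finset.univ.filter fun b : Fin t => a < b).image q)).inf
          (fun w => ((Site.supNorm (q a - w) : ℕ) : ℕ∞))).toNat)) * oneArmProb d p (N - k * (2 * n + 2)) := by
        rw [hprod (oneArmProb d p) (Rsw3.oneArmProb_zero hd p)]
    _ ≤ C ^ t * (∏ a : Fin t, oneArmProb d p (((insert (0 : Site d) ((Finset.univ.filter fun b : Fin t => a < b).image q)).inf
          (fun w => ((Site.supNorm (q a - w) : ℕ) : ℕ∞))).toNat)) * oneArmProb d p (N - t * (2 * n + 2)) :=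
        mul_le_mul (mul_le_mul_of_nonneg_right hCk hW0) hπN (hπ _).le (mul_nonneg (le_trans zero_le_one (one_le_pow₀ hC1)) hW0)

end Summit.CriticalPhenomena.PercolationContinuityZ3.Theorems.Crossing

end
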